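import Mathlib
import Literature.MathematicalPhysics.QuantumLattice.HubbardBandSectorCountingToolbox
import Summits.HubbardSuperconductivity.HubbardSuperconductivity.Theorems.KLProgrammeKLRegimeTwoPointLimitShellAngularBoundCaustic
import Summits.HubbardSuperconductivity.HubbardSuperconductivity.Theorems.KLProgrammeKLRegimeTwoPointLimitShellSectorFibreCount
import HarnessLib

/-!
# Route `KLProgramme` — crux K3 `KLRegimeTwoPointLimit` (stmt-HubbardSuperconductivity-19937), support:
# the CAUSTIC-KEYED fibre count (the collinear family of BGM's Lemma 3.1; U5-NOTE §1(b) correction)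

Cell `gate-hubbard-kl`, seat p1b. Companion of `…ShellSectorFibreCount` (Cooper-keyed / generic fibre
counts). With the notation there (`θ₁, θ₂` fixed, transfer `W = -(p_μ(θ₁) + p_μ(θ₂))`, grid `θ_c = w/2 + cw`,
`N w = 2π`, threshold `C_δ w`):

* `klfc_exists_fibre_count_caustic` — for every `v > 0` there are `w₀, c₀, K₁, K₃ > 0` (depending only on
  `B`, the margin, `C_δ`, `v`) such that for `0 < w ≤ w₀`, `W` at torus sup-distance `≥ v` from `2πℤ²` and
  at sup-distance `≥ r ≥ c₀ w` from the caustic `2F_μ + 2πℤ²`: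
  `#{c < N : |h(θ₁, θ₂, θ_c)| ≤ C_δ w} ≤ K₁ + K₃/√r` — the collinear family's fibre, degrading only like
  `dist(W, 2F)^{-1/2}` (Lemma E.3's sharp law `klan_exists_caustic_refined`), no logarithm per fibre.
Summed over the `a` with `dist(W(θ₁,θ_a), 2F) ≍ 4^{-s}` this is `O(1/w)` per caustic-distance class; the
`½|h|` of the collinear family in BGM's total count is the number of such classes.
-/

noncomputable section

-- the tree's namespace `Summit.<Summit>.<Problem>.Theorems` repeats the summit name by design (D-0017)
set_option linter.dupNamespace false

open Real Set MeasureTheory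
open scoped ENNReal
open Literature.MathematicalPhysics.QuantumLattice
open Literature.MathematicalPhysics.QuantumLattice.BandSectorCounting

namespace Summit.HubbardSuperconductivity.HubbardSuperconductivity.Theorems

section Main

variable {a b : ℝ} (B : BandBounds a b)
include B

/-- **The caustic-keyed fibre count.** See the module docstring. -/
theorem klfc_exists_fibre_count_caustic {ηs Cδ v : ℝ} (hηs : 0 < ηs) (hCδ : 0 < Cδ) (hv0 : 0 < v) :
    ∃ w₀ c₀ K₁ K₃ : ℝ, 0 < w₀ ∧ 0 < c₀ ∧ 0 < K₁ ∧ 0 < K₃ ∧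
      ∀ (μ : ℝ), a ≤ μ - ηs → μ + ηs ≤ b → ∀ (θ₁ θ₂ w : ℝ) (N : ℕ), 0 < w → w ≤ w₀ →
        (N : ℝ) * w = 2 * π → ∀ r : ℝ,
        (∀ m₀ m₁ : ℤ,
          v ≤ max |-(bandX μ θ₁ + bandX μ θ₂) - m₀ * (2 * π)| |-(bandY μ θ₁ + bandY μ θ₂) - m₁ * (2 * π)|) →
        c₀ * w ≤ r →
        (∀ (m₀ m₁ : ℤ) (φ : ℝ), r ≤ max |-(bandX μ θ₁ + bandX μ θ₂) - m₀ * (2 * π) - 2 * bandX μ φ|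
          |-(bandY μ θ₁ + bandY μ θ₂) - m₁ * (2 * π) - 2 * bandY μ φ|) →
        ((((Finset.range N).filter fun c : ℕ => |hfun μ θ₁ θ₂ (w / 2 + c * w)| ≤ Cδ * w).card : ℝ)) ≤
          K₁ + K₃ / Real.sqrt r := by
  have hπ := Real.pi_pos
  have hs := B.smax_pos
  obtain ⟨δ₁, c₁, D₁, D₃, hδ₁, hc₁, hD₁, hD₃, hcau⟩ := klan_exists_caustic_refined B hηs hv0
  -- the effective threshold `δ' = (C_δ + 2 s_max) w`
  obtain ⟨κ, hκ⟩ : ∃ x : ℝ, x = Cδ + 2 * B.smax := ⟨_, rfl⟩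
  have hκ0 : 0 < κ := by rw [hκ]; positivity
  have hκ' := hκ0.ne'
  obtain ⟨w₀, hw₀⟩ : ∃ x : ℝ, x = δ₁ / κ := ⟨_, rfl⟩
  have hw₀0 : 0 < w₀ := by rw [hw₀]; positivity
  have hw₀1 : w₀ ≤ δ₁ / κ := by rw [hw₀]
  refine ⟨w₀, c₁ * κ, D₁ * κ, D₃ * κ, hw₀0, by positivity, by positivity, by positivity, ?_⟩
  intro μ hlo hhi θ₁ θ₂ w N hw hww₀ hN
  have hμ : μ ∈ Icc a b := ⟨by linarith, by linarith⟩
  obtain ⟨h1, h2⟩ := B.level hμ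
  -- the transfer and the level function along the fibre
  set W₁ := -(bandX μ θ₁ + bandX μ θ₂) with hW₁
  set W₂ := -(bandY μ θ₁ + bandY μ θ₂) with hW₂
  set G : ℝ → ℝ := fun θ => eps2 (bandX μ θ - W₁) (bandY μ θ - W₂) - μ with hG
  have hGh : ∀ θ, hfun μ θ₁ θ₂ θ = G θ := by
    intro θ
    simp only [hG, hfun, SX, SY, hW₁, hW₂]
    ring_nf
  have hGd : ∀ t, HasDerivAt G
      (2 * (Real.sin (bandX μ t - W₁) * bandVX μ t + Real.sin (bandY μ t - W₂) * bandVY μ t)) t :=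
    fun t => (klst_hasDerivAt_transLevel h1 h2 W₁ W₂ t).sub_const μ
  have hbound : ∀ t, |2 * (Real.sin (bandX μ t - W₁) * bandVX μ t +
      Real.sin (bandY μ t - W₂) * bandVY μ t)| ≤ 4 * B.smax := by
    intro t
    have hsX := abs_sin_le_one (bandX μ t - W₁)
    have hsY := abs_sin_le_one (bandY μ t - W₂)
    have hVX := B.abs_VX_le μ hμ t
    have hVY := B.abs_VY_le μ hμ t
    rw [abs_mul, abs_two]
    have h3 : |Real.sin (bandX μ t - W₁) * bandVX μ t + Real.sin (bandY μ t - W₂) * bandVY μ t| ≤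
        |Real.sin (bandX μ t - W₁)| * |bandVX μ t| + |Real.sin (bandY μ t - W₂)| * |bandVY μ t| := by
      have := abs_add_le (Real.sin (bandX μ t - W₁) * bandVX μ t) (Real.sin (bandY μ t - W₂) * bandVY μ t)
      rwa [abs_mul, abs_mul] at this
    have h4 : |Real.sin (bandX μ t - W₁)| * |bandVX μ t| ≤ 1 * B.smax :=
      mul_le_mul hsX hVX (abs_nonneg _) zero_le_one
    have h5 : |Real.sin (bandY μ t - W₂)| * |bandVY μ t| ≤ 1 * B.smax :=
      mul_le_mul hsY hVY (abs_nonneg _) zero_le_one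
    linarith
  have hLip : ∀ x y : ℝ, |G x - G y| ≤ 4 * B.smax * |x - y| := by
    intro x y
    have h := Convex.norm_image_sub_le_of_norm_deriv_le (f := G) (s := univ) (C := 4 * B.smax)
      (fun t _ => (hGd t).differentiableAt) (fun t _ => by rw [(hGd t).deriv]; exact hbound t)
      convex_univ (mem_univ y) (mem_univ x)
    simpa [Real.norm_eq_abs] using h
  -- the count as a function of the angular sublevel measure
  have hS : ((Finset.range N).filter fun c : ℕ => |hfun μ θ₁ θ₂ (w / 2 + c * w)| ≤ Cδ * w) =
      ((Finset.range N).filter fun c : ℕ => |G (w / 2 + c * w)| ≤ Cδ * w) := by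
    apply Finset.filter_congr
    intro c _
    rw [hGh]
  have hδ' : Cδ * w + 4 * B.smax * (w / 2) = κ * w := by rw [hκ]; ring
  have hκw0 : 0 < κ * w := by positivity
  have hκwδ₁ : κ * w ≤ δ₁ := by
    have := hww₀.trans hw₀1
    rw [le_div_iff₀ hκ0] at this; linarith
  have step : ∀ X : ℝ, 0 ≤ X →
      volume {θ ∈ Icc (0 : ℝ) (0 + 2 * π) | |eps2 (bandX μ θ - W₁) (bandY μ θ - W₂) - μ| ≤ κ * w} ≤
        ENNReal.ofReal X →
      ((((Finset.range N).filter fun c : ℕ => |hfun μ θ₁ θ₂ (w / 2 + c * w)| ≤ Cδ * w).card : ℝ))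
        * w ≤ X := by
    intro X hX hvol
    rw [hS]
    refine klfc_card_mul_le hLip (by positivity) hw hN hX ?_
    rw [hδ']
    exact hvol
  intro r hfar hr hr₂
  -- caustic-keyed: `D₁ κ w + D₃ κ w/√r`
  have hr' : c₁ * (κ * w) ≤ r := by
    have : c₁ * κ * w = c₁ * (κ * w) := by ring
    linarith
  have hvol := hcau μ hlo hhi (κ * w) W₁ W₂ 0 r hκw0 hκwδ₁ hfar hr' hr₂
  have hb := step (D₁ * (κ * w) + D₃ * (κ * w) / Real.sqrt r) (by positivity) hvol
  have key : ((((Finset.range N).filter fun c : ℕ => |hfun μ θ₁ θ₂ (w / 2 + c * w)| ≤ Cδ * w).card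
      : ℝ)) * w ≤ (D₁ * κ + D₃ * κ / Real.sqrt r) * w := by
    have e : (D₁ * κ + D₃ * κ / Real.sqrt r) * w = D₁ * (κ * w) + D₃ * (κ * w) / Real.sqrt r := by
      ring
    rw [e]; exact hb
  exact le_of_mul_le_mul_right key hw

end Main

end Summit.HubbardSuperconductivity.HubbardSuperconductivity.Theorems

end
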